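import Literature.NumberTheory.EllipticCurves.StevensSmoothingTransformProofs
import Summits.BirchSwinnertonDyer.BirchSwinnertonDyer.Theorems.EisensteinDepletionAtTwoStarGlue
import HarnessLib

/-!
# Route `EisensteinDepletionAtTwo`, crux E1M `DepletedLambdaLawAtTwoMod` (item stmt-BirchSwinnertonDyer-20341),
# line `star` — (★-GlueFin, pinned-scale form) LEMMAS: `2`-adic bookkeeping of Stevens' smoothing `Sm_5^5` and of the
# Riemann sums at `p = 2` (sequel: `…StarGlueFinPinned.lean`, `…StarGlueFinCloser.lean`)

Cell `bsd-rank2` (HOME run/shared/lean/pub/bsd-rank2/), seat `bsd-rank2-star-p1` GEN 2 (lead of line `star`). THEOREMS ONLY — no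
definition, no named fact, no `sorry`. HONEST FRAMING: `Λ`-bookkeeping and elementary `2`-adic estimates serving the registered stub
`stub_starGlueFin : StarSymbC → StarEisEight → StarEisFin → StarCoreAtTwo` of the skeleton `Cruxes/DepletedLambdaLawAtTwoMod/Lines/star.lean`
v3 (the FINITE-LEVEL reshape of the Eisenstein half of (★): Stevens smoothing `Sm_5^5` on both sides, fixed scale `8`). The
research / analytic stubs (★-SymbC) (mod-2 cusp congruence on the 5.14 habitat), (★-EisEight) («8 ∣ v on C») and (★-EisFin)
(smoothed finite-level Eisenstein congruence) are NOT proved here; nothing reads an analytic rank; (★)/E1M are NOT proved; BSD is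
not proved by any of this (PARTITION D-0054: none — r_an ≥ 2 axis S0, door T-r3₂).

CONTENT. §1 `Sm_5^5 μ = μ − 5[5]_*μ − 5[5]^*μ + 25μ` (lit's `stevensSmoothing 5`) and the Mazur–Tate–Teitelbaum Riemann sums are
`1`-Lipschitz for the sup norm at each level (`norm_stevensSmoothing_sub_le`, `norm_distributionRiemannSum_sub_le`); the shifts
`a ↦ a·5^{±1}` preserve `a mod 4`; `Sm_5^5 μ_f` is even (`msdMeasure_neg`); the Riemann sums of `Sm_5^5 μ` converge for a bounded
distribution `μ` (`tendsto_distributionRiemannSum_stevensSmoothing_five`). §2 odd integers (`‖n‖₂ = 1` for odd `n`). §3 the cleared smoothing factor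
`P = 16 + 16T − 5T² ∈ Λ`: `red P = T²`, `ι P = 16 + 16T − 5T²`, `(1+T)^1 = 1 + T`, `red(1+T) = 1 + T ≠ 0`.

References: B. Mazur, J. Tate, J. Teitelbaum, Invent. Math. 84 (1986), §I.10–I.13 [MazurTateTeitelbaum1986Invent]; G. Stevens,
*Arithmetic on Modular Curves* (1982), §5.4 [Stevens1982]; L. Washington, GTM 83, §7.1 [Washington1997].
-/

set_option linter.dupNamespace false
set_option autoImplicit false

noncomputable section

open scoped Classical
open scoped MatrixGroups

open Filter Topology CongruenceSubgroup
  Literature.NumberTheory.EllipticCurves Literature.NumberTheory.EllipticCurves.ModularForms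
  Summit.BirchSwinnertonDyer.Rank1Residual.X1.MuLambda

namespace Summit.BirchSwinnertonDyer.BirchSwinnertonDyer.Theorems.DepletionAtTwo

/-! ## §1. `2`-adic bookkeeping of the Stevens smoothing and of the Riemann sums at `p = 2` -/

section Smoothing

/-- `‖5‖₂ = 1`. [folklore] -/
theorem norm_five_padic_two : ‖((5 : ℕ) : ℚ_[2])‖ = 1 := by
  have h1 : ‖((5 : ℤ) : ℚ_[2])‖ ≤ 1 := Padic.norm_int_le_one 5
  have h2 : ¬ ‖((5 : ℤ) : ℚ_[2])‖ < 1 := by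
    rw [Padic.norm_intCast_lt_one_iff]; decide
  have h : ((5 : ℕ) : ℚ_[2]) = ((5 : ℤ) : ℚ_[2]) := by norm_num
  rw [h]
  exact le_antisymm h1 (not_lt.mp h2)

/-- Unfolding of the Stevens smoothing at a class: `(Sm_5^5 μ)(a) = μ(a) − 5μ(a·5⁻¹) − 5μ(a·5) + 5²μ(a)`.
[cite: Stevens1982, §5.4 (PDF p. 73)] -/
theorem stevensSmoothing_five_eq (μ : (n : ℕ) → ZMod (2 ^ n) → ℚ_[2]) (m : ℕ) (a : ZMod (2 ^ m)) :
    stevensSmoothing 5 μ m a =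
      μ m a - ((5 : ℕ) : ℚ_[2]) * μ m (a * ((5 : ℕ) : ZMod (2 ^ m))⁻¹) -
        ((5 : ℕ) : ℚ_[2]) * μ m (a * ((5 : ℕ) : ZMod (2 ^ m))) + ((5 : ℕ) : ℚ_[2]) ^ 2 * μ m a := by
  simp only [stevensSmoothing_def, Pi.add_apply, Pi.sub_apply, Pi.smul_apply, smul_eq_mul, dilate_apply,
    codilate_apply]

/-- **`Sm_5^5` is `1`-Lipschitz for the sup norm at each level**: if `‖μ(a) − ν(a)‖ ≤ r` for every class `a` of level `m`, then
`‖(Sm_5^5 μ)(a) − (Sm_5^5 ν)(a)‖ ≤ r` (`Sm = 1 − 5[5]_* − 5[5]^* + 25`, integer coefficients). [cite: Stevens1982, §5.4 (PDF p. 73)] -/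
theorem norm_stevensSmoothing_sub_le (μ ν : (n : ℕ) → ZMod (2 ^ n) → ℚ_[2]) {m : ℕ} {r : ℝ}
    (h : ∀ a : ZMod (2 ^ m), ‖μ m a - ν m a‖ ≤ r) (a : ZMod (2 ^ m)) :
    ‖stevensSmoothing 5 μ m a - stevensSmoothing 5 ν m a‖ ≤ r := by
  have h5 : ∀ x : ℚ_[2], ‖((5 : ℕ) : ℚ_[2]) * x‖ = ‖x‖ := fun x ↦ by rw [norm_mul, norm_five_padic_two, one_mul]
  have h25 : ∀ x : ℚ_[2], ‖((5 : ℕ) : ℚ_[2]) ^ 2 * x‖ = ‖x‖ := fun x ↦ by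
    rw [norm_mul, norm_pow, norm_five_padic_two, one_pow, one_mul]
  rw [stevensSmoothing_five_eq μ, stevensSmoothing_five_eq ν]
  have hid : μ m a - ((5 : ℕ) : ℚ_[2]) * μ m (a * ((5 : ℕ) : ZMod (2 ^ m))⁻¹) -
        ((5 : ℕ) : ℚ_[2]) * μ m (a * ((5 : ℕ) : ZMod (2 ^ m))) + ((5 : ℕ) : ℚ_[2]) ^ 2 * μ m a -
      (ν m a - ((5 : ℕ) : ℚ_[2]) * ν m (a * ((5 : ℕ) : ZMod (2 ^ m))⁻¹) -
        ((5 : ℕ) : ℚ_[2]) * ν m (a * ((5 : ℕ) : ZMod (2 ^ m))) + ((5 : ℕ) : ℚ_[2]) ^ 2 * ν m a) =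
      (μ m a - ν m a) - ((5 : ℕ) : ℚ_[2]) * (μ m (a * ((5 : ℕ) : ZMod (2 ^ m))⁻¹) - ν m (a * ((5 : ℕ) : ZMod (2 ^ m))⁻¹)) -
        ((5 : ℕ) : ℚ_[2]) * (μ m (a * ((5 : ℕ) : ZMod (2 ^ m))) - ν m (a * ((5 : ℕ) : ZMod (2 ^ m)))) +
        ((5 : ℕ) : ℚ_[2]) ^ 2 * (μ m a - ν m a) := by ring
  rw [hid]
  refine norm_add_le_of_le_two (norm_sub_le_of_le_two (norm_sub_le_of_le_two (h a) ?_) ?_) ?_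
  · rw [h5]; exact h _
  · rw [h5]; exact h _
  · rw [h25]; exact h _

/-- One-function form: `‖(Sm_5^5 μ)(a)‖ ≤ r` if `‖μ(b)‖ ≤ r` on every class `b` of level `m`. [cite: Stevens1982, §5.4 (PDF p. 73)] -/
theorem norm_stevensSmoothing_le_of_forall_le (μ : (n : ℕ) → ZMod (2 ^ n) → ℚ_[2]) {m : ℕ} {r : ℝ}
    (h : ∀ a : ZMod (2 ^ m), ‖μ m a‖ ≤ r) (a : ZMod (2 ^ m)) :
    ‖stevensSmoothing 5 μ m a‖ ≤ r := by
  have h0 : stevensSmoothing 5 (fun _ _ ↦ (0 : ℚ_[2])) m a = 0 := by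
    rw [stevensSmoothing_five_eq]; ring
  have := norm_stevensSmoothing_sub_le μ (fun _ _ ↦ 0) (fun b ↦ by rw [sub_zero]; exact h b) a
  rwa [h0, sub_zero] at this

/-- **The Riemann sums at `p = 2` are `1`-Lipschitz for the sup norm**: if `‖μ(a) − ν(a)‖ ≤ r` on every class of level `n + 2`
then `‖RS_μ(k,n) − RS_ν(k,n)‖ ≤ r` (`‖C(s,k)‖₂ ≤ 1`, ultrametric). [cite: MazurTateTeitelbaum1986Invent, §I.13] -/
theorem norm_distributionRiemannSum_sub_le (μ ν : (n : ℕ) → ZMod (2 ^ n) → ℚ_[2]) {n : ℕ} {r : ℝ} (hr : 0 ≤ r)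
    (h : ∀ a : ZMod (2 ^ (n + 2)), ‖μ (n + 2) a - ν (n + 2) a‖ ≤ r) (k : ℕ) :
    ‖distributionRiemannSum μ k n - distributionRiemannSum ν k n‖ ≤ r := by
  rw [distributionRiemannSum_two_eq_add μ k n, distributionRiemannSum_two_eq_add ν k n]
  have hid : ∀ (A B A' B' : ℚ_[2]), A + B - (A' + B') = (A - A') + (B - B') := fun _ _ _ _ ↦ by ring
  rw [hid, ← Finset.sum_sub_distrib, ← Finset.sum_sub_distrib]
  refine norm_add_le_of_le_two ?_ ?_ <;>
  · refine IsUltrametricDist.norm_sum_le_of_forall_le_of_nonneg hr fun s _ ↦ ?_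
    rw [← sub_mul, norm_mul]
    calc _ ≤ r * 1 := by
          gcongr
          · exact h _
          · exact norm_cast_choose_le_one _ _
      _ = r := mul_one _

/-- One-function form: `‖RS_μ(k,n)‖ ≤ r` if `‖μ(a)‖ ≤ r` on every class of level `n + 2`. [cite: MazurTateTeitelbaum1986Invent, §I.13] -/
theorem norm_distributionRiemannSum_le (μ : (n : ℕ) → ZMod (2 ^ n) → ℚ_[2]) {n : ℕ} {r : ℝ} (hr : 0 ≤ r)
    (h : ∀ a : ZMod (2 ^ (n + 2)), ‖μ (n + 2) a‖ ≤ r) (k : ℕ) :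
    ‖distributionRiemannSum μ k n‖ ≤ r := by
  have h0 : distributionRiemannSum (fun _ _ ↦ (0 : ℚ_[2])) k n = 0 := by
    rw [distributionRiemannSum_two_eq_add]
    simp
  have := norm_distributionRiemannSum_sub_le μ (fun _ _ ↦ 0) hr (fun a ↦ by rw [sub_zero]; exact h a) k
  rwa [h0, sub_zero] at this

/-- For `m ≥ 2`, multiplication by `5` preserves the class mod `4`: `(a·5).val ≡ a.val (mod 4)`. [folklore] -/
theorem val_mul_five_mod_four {m : ℕ} (hm : 2 ≤ m) (a : ZMod (2 ^ m)) :
    (a * ((5 : ℕ) : ZMod (2 ^ m))).val % 4 = a.val % 4 := by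
  haveI : NeZero (2 ^ m) := ⟨pow_ne_zero _ two_ne_zero⟩
  have h4 : 4 ∣ 2 ^ m := by
    have := pow_dvd_pow 2 hm; simpa using this
  rw [ZMod.val_mul, ZMod.val_natCast, Nat.mod_mod_of_dvd _ h4, Nat.mul_mod, Nat.mod_mod_of_dvd _ h4]
  norm_num

/-- For `m ≥ 2`, multiplication by `5⁻¹` preserves the class mod `4`. [folklore] -/
theorem val_mul_five_inv_mod_four {m : ℕ} (hm : 2 ≤ m) (a : ZMod (2 ^ m)) :
    (a * ((5 : ℕ) : ZMod (2 ^ m))⁻¹).val % 4 = a.val % 4 := by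
  have h5 : ((5 : ℕ) : ZMod (2 ^ m))⁻¹ * ((5 : ℕ) : ZMod (2 ^ m)) = 1 := by
    rw [mul_comm]
    exact ZMod.coe_mul_inv_eq_one 5 (Nat.Coprime.pow_left m (by norm_num : Nat.Coprime 2 5)).symm
  have h := val_mul_five_mod_four hm (a * ((5 : ℕ) : ZMod (2 ^ m))⁻¹)
  rw [mul_assoc, h5, mul_one] at h
  exact h.symm

variable {N : ℕ} [NeZero N] (f : CuspForm (Gamma0 N) 2)

/-- **`Sm_5^5 μ_f` is even** (`μ_f(−a) = μ_f(a)`, `msdMeasure_neg`). [cite: MazurTateTeitelbaum1986Invent, §I.10 (10.1)] -/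
theorem stevensSmoothing_msdMeasure_neg (α : ℚ_[2]) (m : ℕ) (a : ZMod (2 ^ m)) :
    stevensSmoothing 5 (msdMeasure f α) m (-a) = stevensSmoothing 5 (msdMeasure f α) m a := by
  rw [stevensSmoothing_five_eq, stevensSmoothing_five_eq, neg_mul, neg_mul, msdMeasure_neg, msdMeasure_neg,
    msdMeasure_neg]

/-- **The Riemann sums of the smoothing of a bounded distribution converge** to the coefficients of its transform
(`Sm μ = μ − 5[5]_*μ − 5[5]^*μ + 25μ`, each piece a bounded distribution). [cite: Stevens1982, §5.4 (PDF pp. 73–74)]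
[cite: MazurTateTeitelbaum1986Invent, §I.11–I.13] -/
theorem tendsto_distributionRiemannSum_stevensSmoothing_five {μ : (n : ℕ) → ZMod (2 ^ n) → ℚ_[2]}
    (hμ : ∀ (n : ℕ) (a : ZMod (2 ^ n)),
      ∑ b ∈ Finset.univ.filter (fun b : ZMod (2 ^ (n + 1)) ↦
        ZMod.castHom (pow_dvd_pow 2 n.le_succ) (ZMod (2 ^ n)) b = a), μ (n + 1) b = μ n a)
    {C : ℝ} (hC : ∀ (n : ℕ) (a : ZMod (2 ^ n)), ‖μ n a‖ ≤ C) (k : ℕ) :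
    Tendsto (distributionRiemannSum (stevensSmoothing 5 μ) k) atTop
      (𝓝 (PowerSeries.coeff k (distributionTransform (stevensSmoothing 5 μ)))) := by
  have hr : (2 : ℕ).Coprime 5 := by norm_num
  have h1 := tendsto_distributionRiemannSum hμ hC k
  have h2 := tendsto_distributionRiemannSum (dilate_distribution hr hμ) (norm_dilate_le 5 hC) k
  have h3 := tendsto_distributionRiemannSum (codilate_distribution hr hμ) (norm_codilate_le 5 hC) k
  have h := ((h1.sub (h2.const_mul ((5 : ℕ) : ℚ_[2]))).sub (h3.const_mul ((5 : ℕ) : ℚ_[2]))).add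
    (h1.const_mul (((5 : ℕ) : ℚ_[2]) ^ 2))
  have h' : Tendsto (distributionRiemannSum (stevensSmoothing 5 μ) k) atTop
      (𝓝 (PowerSeries.coeff k (distributionTransform μ) -
          ((5 : ℕ) : ℚ_[2]) * PowerSeries.coeff k (distributionTransform (dilate 5 μ)) -
          ((5 : ℕ) : ℚ_[2]) * PowerSeries.coeff k (distributionTransform (codilate 5 μ)) +
          ((5 : ℕ) : ℚ_[2]) ^ 2 * PowerSeries.coeff k (distributionTransform μ))) :=
    h.congr fun n ↦ (distributionRiemannSum_stevensSmoothing μ 5 k n).symm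
  rw [coeff_distributionTransform, h'.limUnder_eq]
  exact h'

end Smoothing

/-! ## §2. Odd integers and `2`-adic units -/

section OnC

/-- An odd integer is a `2`-adic unit: `‖n‖₂ = 1`. [folklore] -/
theorem norm_intCast_eq_one_of_odd {n : ℤ} (hn : Odd n) : ‖(n : ℚ_[2])‖ = 1 := by
  refine le_antisymm (Padic.norm_int_le_one n) (not_lt.mp fun h ↦ ?_)
  rw [Padic.norm_intCast_lt_one_iff] at h
  exact Int.not_even_iff_odd.mpr hn (even_iff_two_dvd.mpr (by exact_mod_cast h))

end OnC


/-! ## §3. The glue: `T²·red(pfree L₀) = red(1+T)·red H` -/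

section GlueFin

/-- `(1+T)^1 = 1 + T` in `Λ = ℤ₂⟦T⟧`. [cite: Washington1997, §7.1] -/
theorem binomialSeries_int_one : PowerSeries.binomialSeries ℤ_[2] (1 : ℤ_[2]) = 1 + PowerSeries.X := by
  have h := PowerSeries.binomialSeries_nat (R := ℤ_[2]) (A := ℤ_[2]) 1
  rw [Nat.cast_one, pow_one] at h
  exact h

/-- The cleared smoothing factor `P = 16 + 16T − 5T² ∈ Λ` reduces to `T²` mod `2`. [cite: Stevens1982, §5.4 (PDF p. 74)] -/
theorem red_smoothingPoly :
    red (PowerSeries.C (16 : ℤ_[2]) + PowerSeries.C (16 : ℤ_[2]) * PowerSeries.X +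
        PowerSeries.C (-5 : ℤ_[2]) * PowerSeries.X ^ 2 : IwasawaAlgebra 2) = PowerSeries.X ^ 2 := by
  have h2 : IsLocalRing.residue ℤ_[2] 2 = 0 := by
    rw [IsLocalRing.residue_eq_zero_iff, PadicInt.maximalIdeal_eq_span_p, Ideal.mem_span_singleton]
    exact ⟨1, by norm_num⟩
  have h16 : IsLocalRing.residue ℤ_[2] 16 = 0 := by
    rw [show (16 : ℤ_[2]) = 2 * 8 by norm_num, map_mul, h2, zero_mul]
  have h5 : IsLocalRing.residue ℤ_[2] (-5) = 1 := by
    rw [show (-5 : ℤ_[2]) = 1 + 2 * (-3) by norm_num, map_add, map_one, map_mul, h2, zero_mul, add_zero]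
  unfold red
  simp only [map_add, map_mul, map_pow, PowerSeries.map_C, PowerSeries.map_X, h16, h5, map_zero, map_one, zero_mul,
    zero_add, one_mul]

/-- `ι(16 + 16T − 5T²) = 16 + 16T − 5T²` in `ℚ₂⟦T⟧`. [folklore] -/
theorem iwasawaToPowerSeries_smoothingPoly :
    iwasawaToPowerSeries 2 (PowerSeries.C (16 : ℤ_[2]) + PowerSeries.C (16 : ℤ_[2]) * PowerSeries.X +
        PowerSeries.C (-5 : ℤ_[2]) * PowerSeries.X ^ 2) =
      PowerSeries.C (16 : ℚ_[2]) + PowerSeries.C (16 : ℚ_[2]) * PowerSeries.X -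
        PowerSeries.C (5 : ℚ_[2]) * PowerSeries.X ^ 2 := by
  simp only [map_add, map_mul, map_pow, PowerSeries.map_X, map_neg, map_ofNat]
  ring

/-- `red(1 + T) ≠ 0` times anything nonzero is nonzero; here: `red(1 + T) = 1 + T`. [folklore] -/
theorem red_one_add_X : red (1 + PowerSeries.X : IwasawaAlgebra 2) = 1 + PowerSeries.X := by
  unfold red
  rw [map_add, map_one, PowerSeries.map_X]

/-- `1 + T ≠ 0` in `𝔽₂⟦T⟧`. [folklore] -/
theorem one_add_X_ne_zero_residueField : (1 + PowerSeries.X : PowerSeries (IsLocalRing.ResidueField ℤ_[2])) ≠ 0 := by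
  intro h
  have := congrArg PowerSeries.constantCoeff h
  simp at this

end GlueFin

end Summit.BirchSwinnertonDyer.BirchSwinnertonDyer.Theorems.DepletionAtTwo

end
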